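import Summits.QuantumFields.YangMills.Theses.SmallCircleAnchor
import Summits.QuantumFields.YangMills.Theorems.ContinuumLegGivenGap.Negative.FrozenXiFatalLattice
import Summits.QuantumFields.YangMills.Theorems.HypercubicLimit.Negative.TruncatedOSForm
import Literature.MathematicalPhysics.QuantumFieldTheory.OSSkeletonExplicitBounds
import Literature.MathematicalPhysics.QuantumLattice.SchwartzTranslationCutoff
import HarnessLib

/-!
# `ContinuumLegGivenGap` (stmt-QuantumFields-15828) — negative side: a FROZEN correlation length is fatal
# for every tamely renormalised witness (criticality along the witness's couplings is necessary)

Support file for the crux item stmt-QuantumFields-15828 (shared decl `ContinuumLegGivenGap` of the routes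
ConvexGribovBody / SmallCircleAnchor / HyperbolicRegulator / ContractibleFibre / ComplexCouplingChannel /
DoublingDefect / NoiseSynchronisation), namespace `…Theorems.ContinuumLegGivenGap.Negative`. It turns the standing
disprover's NEAR-MISS 3 (`Cruxes/ContinuumLegGivenGap/Disproof.lean`, `frozen_fatal_nearMiss`, sorried: "freezing is
fatal; its step (2) needs a (UVB)-type k-uniform equicontinuity bound") and the strategist's N1 (`XiDivergesNecessary`)
into theorems, with the honest side condition made explicit and WITHOUT any equicontinuity input. Lattice half (§1–§2:
the truncated lattice diagonal as a double sum over the exactly centred kernel; the frozen bound):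
`Negative/FrozenXiFatalLattice.lean`; this file is the continuum half (§3) and the theorems (§4).

* `not_isNontrivial_of_frozenXi` — along a scheme `sch` tied to OS data `T` (`IsYangMillsFor r sch T`), if the
  connected torus correlation of a species `s` with its own time translates decays at a `k`-INDEPENDENT lattice
  rate `μ` with a `k`-independent constant (the correlation length of the `s`-channel is frozen in LATTICE units
  along the couplings `β_k` of the scheme — the negation of criticality along the sequence, in the currency of the
  crux's own hypothesis `latticeConnectedCorr`), and the multiplicative renormalisation of `s` is sub-exponential
  in `a_k⁻¹` (every canonical `c = a⁻⁴` or polynomially bounded scheme: `subexp_of_polynomialBound`), then `T` is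
  trivial in `s` (`¬ T.IsNontrivial s`).
* `frequently_unfrozen_of_isNontrivial` — contrapositive: a non-trivial tame witness forces, for every candidate
  rate `μ > 0` and constant `C`, a violation of `|corr_k| ≤ C e^{-μ n}` at infinitely many `k`: the lattice
  correlation length of the channel is unbounded along the witness's couplings.
* `continuumLegGivenGap_witness_unfrozen` — read off the crux BY NAME (`SmallCircleAnchor.ContinuumLegGivenGap`):
  at every compact simple `G` carrying the crux's hypothesis, the witness the crux returns has `β_k → ∞` and, if
  tamely renormalised, an unfrozen curvature correlation length along `β_k` — a subsequential `XiDiverges` for the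
  witness's representation is CONTENT of the crux, not an artefact of line `Sketch`.

Mechanism (no transfer matrix, no reflection positivity on the lattice, no Banach–Steinhaus): by the landed
`HypercubicLimit.Negative.twoPointNontrivial_iff_diagonal` (OS reconstruction without E1, from `OSData`), non-triviality
is positivity of the continuum reflection-diagonal `T(v,v)` for one real positive-time `v`; continuity of
`v ↦ T(v,v)` on `𝓢` (joint continuity of tensors, `continuous_tensorFin`), continuity of translations
(`tendsto_compSubConstCLM_nhds_zero`) and the bump cut-offs (`exists_tsupport_subset_inter_closedBall_tendsto`)
upgrade `v` to a COMPACTLY supported witness with a time MARGIN `t > 0`; by `IsYangMillsFor` its truncated lattice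
diagonal converges to `T(w,w) > 0`; but that diagonal is `c_k² a_k⁸ ∑ₓ∑_y θw(a_k x) w(a_k y) K_k(x,y)` with the EXACTLY
centred kernel (the additive counterterm `m_k` cancels in the truncation — no centring hypothesis), `K_k(x,y)` is the
torus connected correlation of `s` and a spatial translate of `s` at time separation `y⁰ − x⁰ ≥ 2t/a_k` (at most
`L_k` once `a_k L_k ≥ 2R₀`), so the frozen bound and `|c_k| ≤ e^{ε/a_k}` (`ε = μt/2`) give
`|diag_k| ≤ K e^{-μ t/a_k} → 0` — contradiction.

What this does NOT say (recorded for the planners): the side condition on `c_k` is essential to THIS argument — a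
witness with `|c_k| ≥ e^{μδ/a_k}` is not excluded by it (lower bounds on lattice correlations would be needed); and the
reflection-positive norm route of the near-miss cannot remove it, because the corner-plaquette `actionDensity` is not
covariant under any lattice time reflection, so the RP norms of curvature smearings are mixed-species quantities
outside the scheme's control (lead c13 audit, `Cruxes/ContinuumLegGivenGap/NOTES-c13.md`).

References (context): K. Osterwalder, R. Schrader, CMP 31 (1973) §4.1; K. Osterwalder, E. Seiler, Ann. Phys. 110
(1978) §2; J. Glimm, A. Jaffe, *Quantum Physics* (1987) Thm. 6.1.3; A. Jaffe, E. Witten (2000) §5–§6. Tree only: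
`StrongCouplingIRTrivial.TwoPoint` (double-sum form of the lattice two-point function, centred kernel), `YangMillsOS`,
`OSData`, `TruncatedOSForm`. No definitions, no named facts.
-/

noncomputable section

open scoped SchwartzMap
open MeasureTheory Filter Topology
open Literature.MathematicalPhysics.AQFT Literature.MathematicalPhysics.QuantumLattice
open Literature.MathematicalPhysics.QuantumFieldTheory
open Literature.Probability.LatticeModels (Site)
open Summit.QuantumFields.YangMills.Theorems.HypercubicLimit.Negative (osTrunc tensor₁ tensor₂
  isTensorOf_tensor₁ isTensorOf_tensor₂ isOffDiagonal_of_halfSpaces twoPointNontrivial_iff_diagonal osTrunc_thetaTest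
  tsupport_thetaTest_neg)

namespace Summit.QuantumFields.YangMills.Theorems.ContinuumLegGivenGap.Negative

/-! ## §3 Continuum side: a sharp witness of non-triviality (time margin, compact support) -/

section Continuum

variable {ι : Type}

/-- The real one-point tensor `u ↦ (x ↦ u(x₀))` is continuous `𝓢(ℝ⁴, ℝ) → 𝓢((ℝ⁴)¹, ℂ)`. [folklore] -/
theorem continuous_tensor₁ :
    Continuous (tensor₁ : 𝓢(EuclideanSpace ℝ (Fin 4), ℝ) → 𝓢((Fin 1 → EuclideanSpace ℝ (Fin 4)), ℂ)) := by
  have h : Continuous fun u : 𝓢(EuclideanSpace ℝ (Fin 4), ℝ) =>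
      (fun i : Fin 1 => (ofRealTest (![u] i) : 𝓢(EuclideanSpace ℝ (Fin 4), ℂ))) := by
    refine continuous_pi fun i => ?_
    simpa only [Matrix.cons_val_fin_one] using (ofRealTest (E := EuclideanSpace ℝ (Fin 4))).continuous
  exact (continuous_tensorFin (E' := EuclideanSpace ℝ (Fin 4)) 1).comp h

/-- The real reflected two-point tensor `u ↦ θu ⊗ u` is continuous `𝓢(ℝ⁴, ℝ) → 𝓢((ℝ⁴)², ℂ)`. [folklore] -/
theorem continuous_tensor₂_thetaTest :
    Continuous fun u : 𝓢(EuclideanSpace ℝ (Fin 4), ℝ) => tensor₂ (thetaTest 4 u) u := by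
  have hθ : Continuous fun u : 𝓢(EuclideanSpace ℝ (Fin 4), ℝ) => thetaTest 4 u :=
    (thetaTest 4 : 𝓢(EuclideanSpace ℝ (Fin 4), ℝ) →L[ℝ] 𝓢(EuclideanSpace ℝ (Fin 4), ℝ)).continuous
  have hι : Continuous fun u : 𝓢(EuclideanSpace ℝ (Fin 4), ℝ) => (ofRealTest u : 𝓢(EuclideanSpace ℝ (Fin 4), ℂ)) :=
    (ofRealTest (E := EuclideanSpace ℝ (Fin 4))).continuous
  have h : Continuous fun u : 𝓢(EuclideanSpace ℝ (Fin 4), ℝ) =>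
      (fun i : Fin (1 + 1) => (ofRealTest (![thetaTest 4 u, u] i) : 𝓢(EuclideanSpace ℝ (Fin 4), ℂ))) := by
    refine continuous_pi fun i => ?_
    fin_cases i
    · exact (hι.comp hθ).congr fun u => by simp
    · exact hι.congr fun u => by simp
  exact (continuous_tensorFin (E' := EuclideanSpace ℝ (Fin 4)) (1 + 1)).comp h

/-- **Continuity of the reflection-diagonal truncated OS form** `u ↦ T(u,u) = 𝔖₂(θu ⊗ u) − 𝔖₁(θu) 𝔖₁(u)` on
`𝓢(ℝ⁴, ℝ)` (joint continuity of the tensor product). [folklore] -/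
theorem continuous_osTrunc_diag (S : LabelledSchwingerFamily ι (EuclideanSpace ℝ (Fin 4))) (s : ι) :
    Continuous fun u : 𝓢(EuclideanSpace ℝ (Fin 4), ℝ) => osTrunc S s u u := by
  have h : (fun u : 𝓢(EuclideanSpace ℝ (Fin 4), ℝ) => osTrunc S s u u) = fun u =>
      S (1 + 1) (fun _ => s) (tensor₂ (thetaTest 4 u) u) -
        S 1 (fun _ => s) (tensor₁ (thetaTest 4 u)) * S 1 (fun _ => s) (tensor₁ u) := by
    funext u
    have h1 := osTrunc_thetaTest S s (thetaTest 4 u) u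
    rwa [thetaTest_involutive 4 u] at h1
  rw [h]
  exact ((S (1 + 1) (fun _ => s)).continuous.comp continuous_tensor₂_thetaTest).sub
    (((S 1 (fun _ => s)).continuous.comp (continuous_tensor₁.comp (thetaTest 4).continuous)).mul
      ((S 1 (fun _ => s)).continuous.comp continuous_tensor₁))

/-- **A sharp witness.** If `Re T(v,v) > 0` for one real positive-time `v`, then there is a real `w` with a time
MARGIN `t > 0` (`supp w ⊆ {t ≤ y⁰}`), vanishing off a ball `B(0, R₀)`, bounded by `M_w`, and still `Re T(w,w) > 0`:
translate `v` slightly into the future (continuity of translations on `𝓢`), then cut it off far away (the bump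
cut-offs converge in `𝓢`), using the continuity of `u ↦ T(u,u)`. [folklore] -/
theorem exists_sharp_witness (S : LabelledSchwingerFamily ι (EuclideanSpace ℝ (Fin 4))) (s : ι)
    {v : 𝓢(EuclideanSpace ℝ (Fin 4), ℝ)} (hv : tsupport (v : EuclideanSpace ℝ (Fin 4) → ℝ) ⊆ {y | 0 < y 0})
    (hpos : 0 < (osTrunc S s v v).re) :
    ∃ (w : 𝓢(EuclideanSpace ℝ (Fin 4), ℝ)) (t R₀ Mw : ℝ), 0 < t ∧ 0 ≤ R₀ ∧
      tsupport (w : EuclideanSpace ℝ (Fin 4) → ℝ) ⊆ {y | t ≤ y 0} ∧ (∀ z, w z ≠ 0 → ‖z‖ ≤ R₀) ∧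
      (∀ z, |w z| ≤ Mw) ∧ 0 < (osTrunc S s w w).re := by
  have hQ : Continuous fun u : 𝓢(EuclideanSpace ℝ (Fin 4), ℝ) => (osTrunc S s u u).re :=
    Complex.continuous_re.comp (continuous_osTrunc_diag S s)
  set e₀ : EuclideanSpace ℝ (Fin 4) := EuclideanSpace.single 0 1 with he₀
  -- (1) a small time translation into the future keeps positivity and creates a margin
  have hshift : Tendsto (fun τ : ℝ => SchwartzMap.compSubConstCLM ℝ (τ • e₀) v) (𝓝 0) (𝓝 v) := by
    have h1 : Tendsto (fun τ : ℝ => τ • e₀) (𝓝 0) (𝓝 0) := by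
      simpa using (tendsto_id (x := 𝓝 (0 : ℝ))).smul_const e₀
    exact (tendsto_compSubConstCLM_nhds_zero ℝ v).comp h1
  have hev : ∀ᶠ τ : ℝ in 𝓝 0, 0 < (osTrunc S s (SchwartzMap.compSubConstCLM ℝ (τ • e₀) v)
      (SchwartzMap.compSubConstCLM ℝ (τ • e₀) v)).re :=
    ((hQ.tendsto v).comp hshift).eventually_const_lt hpos
  obtain ⟨τ, hτQ, hτpos⟩ :=
    ((hev.filter_mono nhdsWithin_le_nhds).and (self_mem_nhdsWithin (s := Set.Ioi (0 : ℝ)))).exists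
  set u := SchwartzMap.compSubConstCLM ℝ (τ • e₀) v with hu
  have hu_supp : tsupport (u : EuclideanSpace ℝ (Fin 4) → ℝ) ⊆ {y | τ ≤ y 0} := by
    have hK : IsClosed ((fun y : EuclideanSpace ℝ (Fin 4) => y - τ • e₀) ⁻¹' tsupport (v : EuclideanSpace ℝ (Fin 4) → ℝ)) :=
      (isClosed_tsupport _).preimage (continuous_id.sub continuous_const)
    have hsub : Function.support (u : EuclideanSpace ℝ (Fin 4) → ℝ) ⊆
        (fun y : EuclideanSpace ℝ (Fin 4) => y - τ • e₀) ⁻¹' tsupport (v : EuclideanSpace ℝ (Fin 4) → ℝ) := by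
      intro y hy
      rw [Function.mem_support, hu, SchwartzMap.compSubConstCLM_apply] at hy
      exact subset_tsupport _ (Function.mem_support.2 hy)
    refine (closure_minimal hsub hK).trans fun y hy => ?_
    have h := hv hy
    simp only [Set.mem_setOf_eq, he₀] at h ⊢
    have h0 : (y - τ • EuclideanSpace.single (0 : Fin 4) (1 : ℝ)) 0 = y 0 - τ := by simp
    rw [h0] at h
    linarith
  -- (2) a bump cut-off far away keeps positivity and makes the support compact
  obtain ⟨g, hg_supp, hg_lim⟩ := exists_tsupport_subset_inter_closedBall_tendsto u
  have hev2 : ∀ᶠ m : ℕ in atTop, 0 < (osTrunc S s (g m) (g m)).re :=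
    ((hQ.tendsto u).comp hg_lim).eventually_const_lt hτQ
  obtain ⟨m, hm⟩ := hev2.exists
  refine ⟨g m, τ, 2 * ((m : ℝ) + 1), SchwartzMap.seminorm ℝ 0 0 (g m), hτpos, by positivity, ?_, ?_, ?_, hm⟩
  · exact (hg_supp m).trans (Set.inter_subset_left.trans hu_supp)
  · intro z hz
    have hmem := ((hg_supp m) (subset_tsupport _ hz)).2
    rwa [Metric.mem_closedBall, dist_zero_right] at hmem
  · intro z
    rw [← Real.norm_eq_abs]
    exact SchwartzMap.norm_le_seminorm ℝ (g m) z

end Continuum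

/-! ## §4 The theorems -/

section Main

variable {G : Type} [Group G] [TopologicalSpace G] [IsTopologicalGroup G] [CompactSpace G]
  [MeasurableSpace G] [BorelSpace G]

omit [TopologicalSpace G] [IsTopologicalGroup G] [CompactSpace G] [BorelSpace G] in
/-- **Every polynomially bounded multiplicative renormalisation is sub-exponential in `a_k⁻¹`** — in particular the
canonical one `c_k = a_k⁻⁴` of the registered stubs of line `Sketch` ((CAN)): `|c_k| ≤ K a_k^{-p}` for all `k`
implies `|c_k| ≤ e^{ε/a_k}` eventually, for every `ε > 0`. [folklore] -/
theorem subexp_of_polynomialBound (sch : SpeciesScheme (YMSpecies G)) (s : YMSpecies G)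
    (h : ∃ (p : ℕ) (K : ℝ), ∀ k, |sch.c s k| ≤ K * (sch.a k)⁻¹ ^ p) :
    ∀ ε : ℝ, 0 < ε → ∀ᶠ k in atTop, |sch.c s k| ≤ Real.exp (ε * (sch.a k)⁻¹) := by
  intro ε hε
  obtain ⟨p, K, hK⟩ := h
  have hainv : Tendsto (fun k => (sch.a k)⁻¹) atTop atTop :=
    tendsto_inv_nhdsGT_zero.comp
      (tendsto_nhdsWithin_iff.2 ⟨sch.tendsto_a, Eventually.of_forall fun k => sch.a_pos k⟩)
  have h1 : Tendsto (fun x : ℝ => K * ε⁻¹ ^ p * ((ε * x) ^ p * Real.exp (-(ε * x)))) atTop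
      (𝓝 (K * ε⁻¹ ^ p * 0)) :=
    ((Real.tendsto_pow_mul_exp_neg_atTop_nhds_zero p).comp (tendsto_id.const_mul_atTop hε)).const_mul _
  rw [mul_zero] at h1
  have h2 : ∀ᶠ x : ℝ in atTop, K * ε⁻¹ ^ p * ((ε * x) ^ p * Real.exp (-(ε * x))) < 1 :=
    h1.eventually_lt_const one_pos
  filter_upwards [hainv.eventually h2] with k hk
  set x := (sch.a k)⁻¹ with hx
  have hεp : ε⁻¹ ^ p * ε ^ p = 1 := by rw [← mul_pow, inv_mul_cancel₀ hε.ne', one_pow]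
  calc |sch.c s k| ≤ K * x ^ p := hK k
    _ = K * x ^ p * (ε⁻¹ ^ p * ε ^ p) * ((Real.exp (ε * x))⁻¹ * Real.exp (ε * x)) := by
        rw [hεp, inv_mul_cancel₀ (Real.exp_pos _).ne']; ring
    _ = K * ε⁻¹ ^ p * ((ε * x) ^ p * Real.exp (-(ε * x))) * Real.exp (ε * x) := by
        rw [mul_pow, Real.exp_neg]; ring
    _ ≤ 1 * Real.exp (ε * x) := by gcongr
    _ = Real.exp (ε * x) := one_mul _

/-- **A frozen correlation length is fatal for every tamely renormalised witness.** Let OS data `T` be tied to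
Wilson's lattice theory along the scheme `sch` (`IsYangMillsFor r sch T`) and let `s` be a species (e.g. the
curvature `r.curvature`). Suppose that along the scheme the connected torus correlation of `s` with its translates by
`n ≤ L_k` lattice units of Euclidean time and an arbitrary spatial offset `z` decays at a `k`-INDEPENDENT lattice rate
`μ > 0` with a `k`-independent constant — the correlation length of the `s`-channel, in lattice units, stays bounded
along the couplings `β_k` (FROZEN; under `HasWeakCouplingLimit` the negation of criticality along the sequence) — and
that the multiplicative renormalisation of `s` is sub-exponential in `a_k⁻¹` (`subexp_of_polynomialBound`). Then `T`
is trivial in `s`. (The disprover's NEAR-MISS 3 made a theorem; no equicontinuity, transfer matrix or lattice RP is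
used.) [folklore] -/
theorem not_isNontrivial_of_frozenXi (r : LatticeRep G) (sch : SpeciesScheme (YMSpecies G)) (s : YMSpecies G)
    (T : OSData (YMSpecies G) 4) (hYM : IsYangMillsFor r sch T)
    (hfrozen : ∃ μ C : ℝ, 0 < μ ∧ ∀ᶠ k in atTop, ∀ (z : Site 4) (n : ℕ), z 0 = 0 → n ≤ sch.L k →
      |latticeConnectedCorr r.ρ (sch.β k) (2 * sch.L k + 1) s.F (s.F ∘ configShift z) n| ≤
        C * Real.exp (-(μ * n)))
    (hc : ∀ ε : ℝ, 0 < ε → ∀ᶠ k in atTop, |sch.c s k| ≤ Real.exp (ε * (sch.a k)⁻¹)) :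
    ¬ T.IsNontrivial s := by
  intro hnt
  obtain ⟨μ, C, hμ, hfro⟩ := hfrozen
  have hOS : OSReconstructionNoE1 T.schwinger := OSReconstructionNoE1.of_osAxioms T.osAxioms
  -- non-triviality as positivity of the continuum diagonal, then a sharp witness
  obtain ⟨v, hv, hpos⟩ := (twoPointNontrivial_iff_diagonal hOS T.normalized s).1 hnt
  obtain ⟨w, t, R₀, Mw, ht, hR₀, hmargin, hball, hMw, hwpos⟩ := exists_sharp_witness T.schwinger s hv hpos
  have hw : tsupport (w : EuclideanSpace ℝ (Fin 4) → ℝ) ⊆ {y | 0 < y 0} :=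
    fun y hy => lt_of_lt_of_le ht (hmargin hy)
  have hu : tsupport (thetaTest 4 w : EuclideanSpace ℝ (Fin 4) → ℝ) ⊆ {y | y 0 < 0} := tsupport_thetaTest_neg hw
  -- the truncated lattice diagonal converges to `T(w,w)`: the convergence clause on the off-diagonal tensor `θw ⊗ w`
  set D : ℕ → ℝ := fun k =>
    latticeSchwinger r.ρ sch (fun s => s.F) k (1 + 1) (fun _ => s) ![thetaTest 4 w, w] -
      latticeSchwinger r.ρ sch (fun s => s.F) k 1 (fun _ => s) ![thetaTest 4 w] *
        latticeSchwinger r.ρ sch (fun s => s.F) k 1 (fun _ => s) ![w] with hD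
  have h2 := hYM (1 + 1) (by norm_num) (fun _ => s) ![thetaTest 4 w, w] (tensor₂ (thetaTest 4 w) w)
    (isTensorOf_tensor₂ _ _) (isOffDiagonal_of_halfSpaces hu hw (isTensorOf_tensor₂ _ _))
  have hu1 := hYM 1 one_ne_zero (fun _ => s) ![thetaTest 4 w] (tensor₁ (thetaTest 4 w)) (isTensorOf_tensor₁ _)
    (fun x hx => by obtain ⟨i, j, hij, -⟩ := hx; exact absurd (Subsingleton.elim i j) hij)
  have hv1 := hYM 1 one_ne_zero (fun _ => s) ![w] (tensor₁ w) (isTensorOf_tensor₁ _)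
    (fun x hx => by obtain ⟨i, j, hij, -⟩ := hx; exact absurd (Subsingleton.elim i j) hij)
  have hT0 : osTrunc T.schwinger s w w = T.schwinger (1 + 1) (fun _ => s) (tensor₂ (thetaTest 4 w) w) -
      T.schwinger 1 (fun _ => s) (tensor₁ (thetaTest 4 w)) * T.schwinger 1 (fun _ => s) (tensor₁ w) := by
    have h := osTrunc_thetaTest T.schwinger s (thetaTest 4 w) w
    rwa [thetaTest_involutive 4 w] at h
  have hT : Tendsto (fun k => (D k : ℂ)) atTop (𝓝 (osTrunc T.schwinger s w w)) := by
    rw [hT0]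
    exact (h2.sub (hu1.mul hv1)).congr fun k => by simp only [hD]; push_cast; ring
  have hre : Tendsto D atTop (𝓝 (osTrunc T.schwinger s w w).re) := by
    have := (Complex.continuous_re.tendsto _).comp hT
    simpa [Function.comp_def] using this
  -- the frozen bound forces the same diagonal to zero
  have hC0 : 0 ≤ C := by
    obtain ⟨k, hk⟩ := hfro.exists
    have h0 : (0 : ℝ) ≤ C * Real.exp (-(μ * ((0 : ℕ) : ℝ))) := (abs_nonneg _).trans (hk 0 0 rfl (Nat.zero_le _))
    simpa using h0
  have hainv : Tendsto (fun k => (sch.a k)⁻¹) atTop atTop :=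
    tendsto_inv_nhdsGT_zero.comp
      (tendsto_nhdsWithin_iff.2 ⟨sch.tendsto_a, Eventually.of_forall fun k => sch.a_pos k⟩)
  set K₀ : ℝ := (2 * R₀ + 1) ^ 8 * Mw ^ 2 * C with hK₀
  have hMw0 : 0 ≤ Mw := (abs_nonneg _).trans (hMw 0)
  have hK0 : 0 ≤ K₀ := by positivity
  have hbound : ∀ᶠ k in atTop, |D k| ≤ K₀ * Real.exp (-(μ * t * (sch.a k)⁻¹)) := by
    have hev : ∀ᶠ k in atTop, sch.a k ≤ 1 ∧ 2 * R₀ ≤ sch.a k * sch.L k :=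
      ((sch.tendsto_a.eventually (gt_mem_nhds one_pos)).mono fun k hk => hk.le).and
        (sch.tendsto_L.eventually_ge_atTop (2 * R₀))
    filter_upwards [hev, hfro, hc _ (by positivity : 0 < μ * t / 2)] with k hk hfk hck
    have hmain := abs_latticeTrunc_le_of_frozen r sch s hμ hC0 ht hR₀ hmargin hball hMw k hk.1 hk.2 hfk
    have hc2 : sch.c s k ^ 2 ≤ Real.exp (μ * t * (sch.a k)⁻¹) := by
      have habs : |sch.c s k| ^ 2 ≤ Real.exp (μ * t / 2 * (sch.a k)⁻¹) ^ 2 :=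
        pow_le_pow_left₀ (abs_nonneg _) hck 2
      rw [sq_abs, sq (Real.exp _), ← Real.exp_add] at habs
      convert habs using 2
      ring
    calc |D k| ≤ sch.c s k ^ 2 * K₀ * Real.exp (-(2 * μ * t * (sch.a k)⁻¹)) := hmain
      _ ≤ Real.exp (μ * t * (sch.a k)⁻¹) * K₀ * Real.exp (-(2 * μ * t * (sch.a k)⁻¹)) := by gcongr
      _ = K₀ * Real.exp (-(μ * t * (sch.a k)⁻¹)) := by
          rw [mul_comm (Real.exp _) K₀, mul_assoc, ← Real.exp_add]
          congr 2
          ring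
  have hlim : Tendsto (fun k => K₀ * Real.exp (-(μ * t * (sch.a k)⁻¹))) atTop (𝓝 0) := by
    have h1 : Tendsto (fun k => -(μ * t * (sch.a k)⁻¹)) atTop atBot :=
      tendsto_neg_atTop_atBot.comp (hainv.const_mul_atTop (by positivity : 0 < μ * t))
    simpa using (Real.tendsto_exp_atBot.comp h1).const_mul K₀
  have hzero : Tendsto D atTop (𝓝 0) :=
    squeeze_zero_norm' (hbound.mono fun k hk => by rwa [Real.norm_eq_abs]) hlim
  have h0 := tendsto_nhds_unique hre hzero
  exact absurd h0 hwpos.ne'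

/-- **Contrapositive: a non-trivial tame witness has an unfrozen correlation length.** If `T` is tied to the
lattice along `sch`, non-trivial in the species `s`, and `s` is sub-exponentially renormalised, then for every
candidate lattice rate `μ > 0` and every constant `C` the frozen bound `|corr_k(s, s ∘ τ_z; n)| ≤ C e^{-μ n}`
(`z⁰ = 0`, `n ≤ L_k`) FAILS at infinitely many `k`: the correlation length of the `s`-channel, in lattice units, is
unbounded along the witness's couplings. [folklore] -/
theorem frequently_unfrozen_of_isNontrivial (r : LatticeRep G) (sch : SpeciesScheme (YMSpecies G))
    (s : YMSpecies G) (T : OSData (YMSpecies G) 4) (hYM : IsYangMillsFor r sch T) (hnt : T.IsNontrivial s)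
    (hc : ∀ ε : ℝ, 0 < ε → ∀ᶠ k in atTop, |sch.c s k| ≤ Real.exp (ε * (sch.a k)⁻¹)) {μ : ℝ} (hμ : 0 < μ)
    (C : ℝ) :
    ∃ᶠ k in atTop, ∃ (z : Site 4) (n : ℕ), z 0 = 0 ∧ n ≤ sch.L k ∧
      C * Real.exp (-(μ * n)) <
        |latticeConnectedCorr r.ρ (sch.β k) (2 * sch.L k + 1) s.F (s.F ∘ configShift z) n| := by
  by_contra hnot
  rw [Filter.not_frequently] at hnot
  refine not_isNontrivial_of_frozenXi r sch s T hYM ⟨μ, C, hμ, ?_⟩ hc hnt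
  filter_upwards [hnot] with k hk z n hz hn
  by_contra hlt
  push Not at hlt
  exact hk ⟨z, n, hz, hn, hlt⟩

/-- **Read off the crux BY NAME: criticality along the witness's couplings is content of `ContinuumLegGivenGap`.**
Whoever proves `SmallCircleAnchor.ContinuumLegGivenGap` (character-identical twins in the six other wanting routes)
proves, for every compact simple `G` carrying the crux's hypothesis (per-β torus clustering in every faithful `r`),
the existence of a witness `(r, sch, T)` with `β_k → ∞`, tied to the lattice and non-trivial in the curvature, whose
curvature correlation length — IF the witness is tamely (sub-exponentially, e.g. canonically) renormalised — is NOT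
frozen in lattice units along `β_k`: every frozen bound fails infinitely often. A subsequential `XiDiverges` for the
witness's representation is therefore part of the crux, not an artefact of line `Sketch` (strategist N1
`XiDivergesNecessary`, disprover NEAR-MISS 3). [folklore] -/
theorem continuumLegGivenGap_witness_unfrozen
    (h : Summit.QuantumFields.YangMills.Theses.SmallCircleAnchor.ContinuumLegGivenGap) :
    ∀ (G : Type) [Group G] [TopologicalSpace G] [IsTopologicalGroup G] [CompactSpace G],
      IsCompactSimpleLieGroup G → letI : MeasurableSpace G := borel G; haveI : BorelSpace G := ⟨rfl⟩;
      (∀ r : LatticeRep G, ∃ β₀ : ℝ, ∀ β : ℝ, β₀ ≤ β → ∃ m : ℝ, 0 < m ∧ ∃ S₁ : ℕ,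
          ∀ A B : YMSpecies G, ∃ C : ℝ, ∀ S n : ℕ, S₁ ≤ S → n ≤ S →
            |latticeConnectedCorr r.ρ β (2 * S + 1) A.F B.F n| ≤ C * Real.exp (-(m * n))) →
        ∃ (r : LatticeRep G) (sch : SpeciesScheme (YMSpecies G)) (T : OSData (YMSpecies G) 4),
          sch.HasWeakCouplingLimit ∧ IsYangMillsFor r sch T ∧ T.IsNontrivial r.curvature ∧
            ((∀ ε : ℝ, 0 < ε → ∀ᶠ k in atTop, |sch.c r.curvature k| ≤ Real.exp (ε * (sch.a k)⁻¹)) →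
              ∀ (μ C : ℝ), 0 < μ → ∃ᶠ k in atTop, ∃ (z : Site 4) (n : ℕ), z 0 = 0 ∧ n ≤ sch.L k ∧
                C * Real.exp (-(μ * n)) <
                  |latticeConnectedCorr r.ρ (sch.β k) (2 * sch.L k + 1) r.curvature.F
                      (r.curvature.F ∘ configShift z) n|) := by
  intro G _ _ _ _ hG
  letI : MeasurableSpace G := borel G
  haveI : BorelSpace G := ⟨rfl⟩
  intro hgap
  obtain ⟨r, sch, T, hw, hYM, hnt, -, -⟩ := h G hG hgap
  exact ⟨r, sch, T, hw, hYM, hnt, fun hc μ C hμ =>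
    frequently_unfrozen_of_isNontrivial r sch r.curvature T hYM hnt hc hμ C⟩

end Main

end Summit.QuantumFields.YangMills.Theorems.ContinuumLegGivenGap.Negative

end
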